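import Literature.NumberTheory.LFunctions.Zhang2022.RepairRplusTightness

/-!
# Zhang (2022) §18-margin repair rung — the two-piece class in the JOINT (T-true) currency:
# `C₂₃₂·C₂₃₃ < |𝔡+𝔡′|²` fails for every smooth two-piece design against every in-class probe, in every
# invisible off-diagonal world; the E*-slot is inhabited and load-bearing

Trunk T-ANT (NumberTheory/LFunctions). Y. Zhang, *Discrete mean estimates and the Landau–Siegel
zero*, arXiv:2211.02515v1 (2022) [Zhang2022LandauSiegel] — **an unrefereed manuscript under
adjudication. WHAT THIS IS NOT: nothing here asserts or denies its Theorems 1–2 or any analytic lemma;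
no claim about Landau–Siegel zeros, about Parity, or about a repaired `Margin232` is made. Every
statement is about the manuscript's METHOD AS ARCHITECTED (the main-term calculus continued past `P`),
not about zeros of `L`-functions.** Cell `landau-siegel` (rung F-S3), sub-cell E (barrier extension),
seat p1, stubs S-E-p1-5 (joint currency) and S-E-p1-4b (slot inhabited) of barrier/ASSIGNMENTS.md;
companion of `RepairRplus` (p455670: `Repair.not_repairable_in_Rplus`, whose two-piece verdict is in the
POSITIVITY currency `¬ (twoPieceMainTerm < 0)`) and `RepairRplusTightness` (p456612).

## The joint currency for a two-piece design

The §2 endgame of the manuscript closes at main order iff `C₂₃₂·C₂₃₃ < |𝔡+𝔡′|²` (T-true; in class `R`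
this is `C232S θ * C233T θ < ‖dSumS θ‖²`, refuted by `Repair.not_repairable_true_need`). For a smooth
two-piece design `s·u ⊕ v` of length `θ ≥ 1` (`KnifeEdge.InClassPiece u u′`, `KnifeEdge.OverhangPiece θ
v v′`, weight `s ∈ ℂ`) judged against an in-class PROBE `f` (`KnifeEdge.InClassPiece f f′` — the
manuscript's probe is the `J₁`-tent, supported inside `(0,1)`), in an off-diagonal world
`X : KnifeEdge.PairFunctional`, the three constants of the continued calculus are

* `C₂₃₂ = KnifeEdge.twoPieceMainTerm θ X u u′ v v′ s` (p442741: in-class block `|s|²𝔅(u)`, cross block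
  `2Re(s·(π·conj Φ_v·L(u) + X(u,v)))`, overhang block `Re 𝔅_θ(v) + 2Re X(v,v)`);
* `C₂₃₃ = 𝔅(f) = mainTermForm f f′` (the probe has top `≤ 1`: no overhang, no off-diagonal slot);
* `𝔡+𝔡′ = twoPieceCross θ X u u′ v v′ s f f′ := s·P(u,f) + conj(π·conj Φ_v·L(f) + X(f,v))` (defined here):
  the polar cross of the in-class pieces `P(u,f) = mainTermFormPolar u u′ f f′` plus the continued polar
  pairing of the overhang with the probe. By the PROVED rank-one tail coupling
  (`KnifeEdge.rankOneTailCoupling_holds`: `M_θ(f,v) = π·conj Φ_v·L(f)`, `M_θ(v,f) = 0`) the continued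
  polar pairing `P_θ(v,f) = M_θ(v,f) + conj M_θ(f,v)` IS `conj(π·conj Φ_v·L(f))`, and the world's
  correction to `P_θ(v,f)` is `conj X(f,v)` — the Hermitian convention already used by
  `twoPieceMainTerm` (whose `(v,u)` block is the conjugate of its `(u,v)` block; cf.
  `mainTermFormPolar_swap`). No new slot is needed: the SAME displayed E*-slot
  `KnifeEdge.InvisibleOverhang θ X` (kind (c), registry E-002; a bare `Prop`, NOT asserted), applied to the
  in-class probe `f`, kills the `(f,v)` pairing.

## Results

* S-E-p1-4b `exists_invisibleOverhang θ : ∃ X, InvisibleOverhang θ X` — the slot is INHABITED for every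
  `θ` (an explicit world defined by cases; re-proves the referee's probe in tree), so no verdict
  quantifying over invisible worlds is vacuous;
* `twoPieceCross_of_invisible`: under the slot `𝔡+𝔡′ = s·P(u,f)`; with p442741's
  `twoPieceMainTerm_of_invisible` (`C₂₃₂ = |s|²𝔅(u)`) and Cauchy–Schwarz for `𝔅`
  (`norm_sq_mainTermFormPolar_le`): `norm_sq_twoPieceCross_le_of_invisible`
  (`|𝔡+𝔡′|² ≤ C₂₃₂·C₂₃₃`), **`not_jointCloses_of_invisible`** (`¬ (C₂₃₂·C₂₃₃ < |𝔡+𝔡′|²)`) and the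
  `√`-shape `not_sqrt_jointCloses_of_invisible`;
* TIGHTNESS (the slot is load-bearing in this currency too): in the continued calculus `X = 0` the
  design `s·g⋆ ⊕ φ_θ` against the probe `g⋆` has `C₂₃₂·C₂₃₃ = 0` (`𝔅(g⋆) = 0`,
  `Repair.mainTermForm_gStar`) but `𝔡+𝔡′ = 24πΦ(θ) ≠ 0` (`twoPieceCross_zero_gStar`), so the joint
  criterion CLOSES at every `θ > 1` and every `s` (`jointCloses_zero`) — consistent with
  `Repair.not_invisibleOverhang_zero` (p456612);
* extension protocol of `RepairRplus`: `JointDesign` (design + probe), `familyTwoPieceJoint`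
  (K = `1 ≤ θ ∧ InClassPiece u ∧ OverhangPiece θ v ∧ InClassPiece f` — DECLARED NARROWINGS w.r.t. the class
  text «v 1-Lipschitz, ‖v‖∞ ≤ 1»: `OverhangPiece` asks a right derivative in `L²(1,θ)` instead, as in
  `familyTwoPiece`; probe = in-class piece with `f(1) = 0`; V = `∀ X, InvisibleOverhang θ X → ¬ joint
  closing`), `familyTwoPieceJoint_decided`, the forgetful link to `familyTwoPiece`
  (`familyTwoPieceJoint_toTwoPiece`), the member `jointDesignStar θ s` (`g⋆ ⊕ φ_θ` against `g⋆`) and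
  `familyTwoPieceJoint_slot_loadBearing`.

CURRENCY (REF-E C3(e)): continued calculus past `P` (`Repair.MformTop θ`); whether these constants are the
(A)-world main terms of a two-piece design is registry E-017 / E-002, open — not claimed.

## References

* Y. Zhang, arXiv:2211.02515v1 (2022), §2 Props. 2.4–2.6, (2.18), (2.32)–(2.33) [p. 10–11], §7 Prop.
  7.1, (7.2) [p. 44], §8 (8.11)–(8.12), §10 (10.1), (10.17). [cite: Zhang2022LandauSiegel, §§2, 7, 8, 10]
-/

noncomputable section

open Real Complex ComplexConjugate Set
open _root_.MeasureTheory

namespace Literature.NumberTheory.LFunctions.Zhang2022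

namespace Repair

open KnifeEdge

variable {θ : ℝ} {X : PairFunctional} {u u' v v' f f' : ℝ → ℂ}

/-! ### S-E-p1-4b — the E*-slot is inhabited: an explicitly invisible world for every `θ` -/

/-- A piece that is both in-class and an overhang piece is identically zero (with its marked
derivative): the two vanishing clauses cover `ℝ`. [cite: Zhang2022LandauSiegel, §7 (7.2) p.44] -/
theorem eq_zero_of_inClass_of_overhang (hu : InClassPiece v v') (hv : OverhangPiece θ v v') :
    v = (fun _ => 0) ∧ v' = (fun _ => 0) := by
  refine ⟨funext fun y => ?_, funext fun y => ?_⟩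
  · rcases le_or_gt 1 y with h | h
    · exact hu.vanish y h
    · exact hv.vanish y h.le
  · rcases le_or_gt 1 y with h | h
    · exact hu.vanish' y h
    · exact hv.vanish' y h

/-- The continued formula I of the zero profile against anything vanishes.
[cite: Zhang2022LandauSiegel, §8 (8.11)–(8.12)] -/
theorem MformTop_zero_left (θ : ℝ) (h h' : ℝ → ℂ) :
    MformTop θ (fun _ => 0) (fun _ => 0) h h' = 0 := by
  simp [MformTop, dipoleIntegrandTop]

/-- **The E*-slot `InvisibleOverhang θ X` is inhabited for every `θ`** (REF-E C4 on the slot; re-proves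
the referee's probe in tree): the world which corrects the `(in-class, overhang)` pairing by minus the
tail coupling and the overhang block by minus half its real part is invisible. So no verdict of the form
`∀ X, InvisibleOverhang θ X → …` is vacuously true. (That the TRUE off-diagonal world of a smooth design is
invisible is registry E-002 — not claimed.) [cite: Zhang2022LandauSiegel, §7 (7.2) p.44] -/
theorem exists_invisibleOverhang (θ : ℝ) : ∃ X : PairFunctional, InvisibleOverhang θ X := by
  classical
  refine ⟨fun a a' b b' =>
    if a = b ∧ a' = b' then (if OverhangPiece θ b b' then (((-(topDiagForm θ b b').re / 2 : ℝ)) : ℂ) else 0)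
    else (if InClassPiece a a' ∧ OverhangPiece θ b b'
      then -((π : ℂ) * conj (overhangMass θ b) * tailFunctional a) else 0), ?_⟩
  intro a a' b b' ha hb
  refine ⟨?_, ?_⟩
  · by_cases hab : a = b ∧ a' = b'
    · -- the corner `u = v`: both pieces vanish identically, and both sides are `0`
      obtain ⟨rfl, rfl⟩ := hab
      obtain ⟨h0, h0'⟩ := eq_zero_of_inClass_of_overhang ha hb
      subst h0 h0'
      simp [topDiagForm, MformTop_zero_left, overhangMass, tailFunctional]
    · simp [hab, ha, hb]
  · beta_reduce
    rw [if_pos ⟨rfl, rfl⟩, if_pos hb, Complex.ofReal_re]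
    ring

/-! ### The cross constant `𝔡+𝔡′` of a two-piece design against an in-class probe -/

/-- **The cross main-order constant of `s·u ⊕ v` against the in-class probe `f` in the world `X`:**
`twoPieceCross θ X u u′ v v′ s f f′ := s·P(u,f) + conj(π·conj Φ_v·L(f) + X(f,v))` — the polar cross of the
in-class pieces (`mainTermFormPolar`, no off-diagonal slot at tops `≤ 1`) plus the continued polar pairing
of the overhang with the probe, `P_θ(v,f) = M_θ(v,f) + conj M_θ(f,v) = conj(π·conj Φ_v·L(f))` by the
rank-one tail coupling (`M_θ(v,f) = 0`), corrected by the world (Hermitian convention of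
`KnifeEdge.twoPieceMainTerm`: the correction to `P_θ(v,f)` is `conj X(f,v)`). The `X = 0` value is the
continued calculus. [cite: Zhang2022LandauSiegel, §10 (10.1), (10.17); §8 (8.11)–(8.12); §7 (7.2) p.44] -/
def twoPieceCross (θ : ℝ) (X : PairFunctional) (u u' v v' : ℝ → ℂ) (s : ℂ) (f f' : ℝ → ℂ) : ℂ :=
  s * mainTermFormPolar u u' f f' + conj ((π : ℂ) * conj (overhangMass θ v) * tailFunctional f + X f f' v v')

/-- **Consistency with the rank-one coupling**: for `θ ≥ 1` the continued polar pairing of the overhang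
with an in-class probe, `M_θ(v,f) + conj M_θ(f,v)`, IS the `X = 0` tail term of `twoPieceCross`.
[cite: Zhang2022LandauSiegel, §8 (8.11)–(8.12); §7 (7.2) p.44] -/
theorem twoPieceCross_zero_eq_MformTop (hθ : 1 ≤ θ) (hf : InClassPiece f f') (hv : OverhangPiece θ v v')
    (s : ℂ) :
    twoPieceCross θ 0 u u' v v' s f f'
      = s * mainTermFormPolar u u' f f' + (MformTop θ v v' f f' + conj (MformTop θ f f' v v')) := by
  obtain ⟨h1, h2⟩ := rankOneTailCoupling_holds hθ f f' v v' hf hv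
  unfold twoPieceCross
  rw [h1, h2, zero_add, Pi.zero_apply, Pi.zero_apply, Pi.zero_apply, Pi.zero_apply, add_zero]

/-! ### The joint verdict in every invisible world -/

/-- Under the slot the `(f,v)` pairing cancels: `𝔡+𝔡′ = s·P(u,f)`.
[cite: Zhang2022LandauSiegel, §10 (10.17); §7 (7.2) p.44] -/
theorem twoPieceCross_of_invisible (h : InvisibleOverhang θ X) (hf : InClassPiece f f')
    (hv : OverhangPiece θ v v') (s : ℂ) :
    twoPieceCross θ X u u' v v' s f f' = s * mainTermFormPolar u u' f f' := by
  obtain ⟨h1, -⟩ := h f f' v v' hf hv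
  unfold twoPieceCross
  rw [h1, add_neg_cancel, map_zero, add_zero]

/-- **Cauchy–Schwarz after cancellation**: in an invisible world, `|𝔡+𝔡′|² ≤ C₂₃₂·C₂₃₃` for every smooth
two-piece design and every in-class probe (`|s·P(u,f)|² ≤ |s|²𝔅(u)·𝔅(f)`, `norm_sq_mainTermFormPolar_le`).
[cite: Zhang2022LandauSiegel, §2 (2.18), (2.32)–(2.33)] -/
theorem norm_sq_twoPieceCross_le_of_invisible (h : InvisibleOverhang θ X) (hu : InClassPiece u u')
    (hv : OverhangPiece θ v v') (hf : InClassPiece f f') (s : ℂ) :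
    ‖twoPieceCross θ X u u' v v' s f f'‖ ^ 2 ≤ twoPieceMainTerm θ X u u' v v' s * mainTermForm f f' := by
  rw [twoPieceCross_of_invisible h hf hv, twoPieceMainTerm_of_invisible h hu hv, norm_mul, mul_pow,
    mul_assoc]
  exact mul_le_mul_of_nonneg_left (norm_sq_mainTermFormPolar_le hu.kinked.isH1 hf.kinked.isH1)
    (sq_nonneg _)

/-- **NO JOINT CLOSING IN AN INVISIBLE WORLD.** For every smooth two-piece design `s·u ⊕ v` (`u` in-class,
`v` overhang of any length `θ`), every in-class probe `f`, and every off-diagonal world `X` carrying the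
displayed E*-slot `InvisibleOverhang θ X`: `¬ (C₂₃₂·C₂₃₃ < |𝔡+𝔡′|²)` — the §2 joint criterion does not
close at main order (continued-calculus currency). Closing therefore needs `¬ InvisibleOverhang`, i.e. an
E*-len⁺(X)-strength input (registry E-002). [cite: Zhang2022LandauSiegel, §2 Props. 2.4–2.6, (2.32)–(2.33); §7 (7.2) p.44] -/
theorem not_jointCloses_of_invisible (h : InvisibleOverhang θ X) (hu : InClassPiece u u')
    (hv : OverhangPiece θ v v') (hf : InClassPiece f f') (s : ℂ) :
    ¬ (twoPieceMainTerm θ X u u' v v' s * mainTermForm f f' < ‖twoPieceCross θ X u u' v v' s f f'‖ ^ 2) :=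
  not_lt.2 (norm_sq_twoPieceCross_le_of_invisible h hu hv hf s)

/-- the same in the `√`-shape of `Section2MainOrder.MainOrderContradiction`:
`¬ (√(C₂₃₂·C₂₃₃) < |𝔡+𝔡′|)`. [cite: Zhang2022LandauSiegel, §2 after (2.33)] -/
theorem not_sqrt_jointCloses_of_invisible (h : InvisibleOverhang θ X) (hu : InClassPiece u u')
    (hv : OverhangPiece θ v v') (hf : InClassPiece f f') (s : ℂ) :
    ¬ (Real.sqrt (twoPieceMainTerm θ X u u' v v' s * mainTermForm f f')
        < ‖twoPieceCross θ X u u' v v' s f f'‖) :=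
  not_lt.2 (Real.le_sqrt_of_sq_le (norm_sq_twoPieceCross_le_of_invisible h hu hv hf s))

/-! ### Tightness: in the continued calculus `X = 0` the joint criterion CLOSES beyond `P` -/

/-- In the world `X = 0`, the cross constant of `s·g⋆ ⊕ φ_θ` against the probe `g⋆` is the pure tail
term `24·π·Φ(θ)` (`P(g⋆,g⋆) = 𝔅(g⋆) = 0`, `L(g⋆) = 24`, `Φ(φ_θ) = phiInt θ`), for `θ ≥ 1` and every `s`.
[cite: Zhang2022LandauSiegel, §7 (7.2) p.44; §8 (8.11)–(8.12)] -/
theorem twoPieceCross_zero_gStar (hθ : 1 ≤ θ) (s : ℂ) :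
    twoPieceCross θ 0 gStar gStar' (phiT θ) (phiT' θ) s gStar gStar' = 24 * (π : ℂ) * ((phiInt θ : ℝ) : ℂ) := by
  unfold twoPieceCross
  rw [mainTermFormPolar_self, mainTermForm_gStar, overhangMass_phiT hθ, tailFunctional_gStar,
    Pi.zero_apply, Pi.zero_apply, Pi.zero_apply, Pi.zero_apply, add_zero]
  have e : (π : ℂ) * conj (((phiInt θ : ℝ) : ℂ)) * 24 = ((π * phiInt θ * 24 : ℝ) : ℂ) := by
    rw [Complex.conj_ofReal]; push_cast; ring
  rw [e, Complex.conj_ofReal]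
  push_cast
  ring

/-- **The joint criterion closes in the world `X = 0` at every `θ > 1`**, for the `R⁺`-member `s·g⋆ ⊕ φ_θ`
against the in-class probe `g⋆` and EVERY weight `s`: `C₂₃₂·C₂₃₃ = (…)·𝔅(g⋆) = 0 < (24πΦ(θ))² = |𝔡+𝔡′|²`.
So the displayed slot of `not_jointCloses_of_invisible` is load-bearing (and `X = 0` is not invisible).
[cite: Zhang2022LandauSiegel, §7 (7.2) p.44; §2 (2.32)–(2.33)] -/
theorem jointCloses_zero (hθ : 1 < θ) (s : ℂ) :
    twoPieceMainTerm θ 0 gStar gStar' (phiT θ) (phiT' θ) s * mainTermForm gStar gStar'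
      < ‖twoPieceCross θ 0 gStar gStar' (phiT θ) (phiT' θ) s gStar gStar'‖ ^ 2 := by
  rw [mainTermForm_gStar, mul_zero, twoPieceCross_zero_gStar hθ.le]
  have hΦ : 0 < phiInt θ := phiInt_pos hθ
  have h : ‖(24 * (π : ℂ) * ((phiInt θ : ℝ) : ℂ))‖ = 24 * π * phiInt θ := by
    rw [show (24 * (π : ℂ) * ((phiInt θ : ℝ) : ℂ)) = ((24 * π * phiInt θ : ℝ) : ℂ) by push_cast; ring,
      Complex.norm_real, Real.norm_eq_abs, abs_of_pos (by positivity)]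
  rw [h]
  positivity

/-! ### Extension protocol: the family «smooth two-piece design + in-class probe, joint currency» -/

/-- A two-piece design together with its probe: length `θ`, in-class piece `u` (derivative `u′`),
overhang piece `v` (`v′`), weight `s`, probe `f` (`f′`). [cite: Zhang2022LandauSiegel, §2 (2.23)–(2.28); §7 (7.2) p.44] -/
structure JointDesign : Type where
  /-- logarithmic length of the overhang (top of `v`) -/
  θ : ℝ
  /-- in-class piece and its marked right derivative -/
  u : ℝ → ℂ
  u' : ℝ → ℂ
  /-- overhang piece and its marked right derivative -/
  v : ℝ → ℂ
  v' : ℝ → ℂ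
  /-- relative weight of the in-class piece -/
  s : ℂ
  /-- the probe and its marked right derivative -/
  f : ℝ → ℂ
  f' : ℝ → ℂ

/-- **family «two-piece, joint currency»**: K = `1 ≤ θ ∧ InClassPiece u u′ ∧ OverhangPiece θ v v′ ∧
InClassPiece f f′` (no analytic hypothesis inside; declared narrowings: `OverhangPiece`'s right derivative in
`L²(1,θ)` in place of «1-Lipschitz, ‖v‖∞ ≤ 1», probe = in-class piece); V = for EVERY world `X` with the
displayed E*-slot `InvisibleOverhang θ X` (kind (c), E-002), `¬ (C₂₃₂·C₂₃₃ < |𝔡+𝔡′|²)`.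
[cite: Zhang2022LandauSiegel, §2 (2.32)–(2.33); §7 (7.2) p.44] -/
def familyTwoPieceJoint : DesignFamily where
  Design := JointDesign
  InClass d := 1 ≤ d.θ ∧ InClassPiece d.u d.u' ∧ OverhangPiece d.θ d.v d.v' ∧ InClassPiece d.f d.f'
  Verdict d := ∀ X : PairFunctional, InvisibleOverhang d.θ X →
    ¬ (twoPieceMainTerm d.θ X d.u d.u' d.v d.v' d.s * mainTermForm d.f d.f'
        < ‖twoPieceCross d.θ X d.u d.u' d.v d.v' d.s d.f d.f'‖ ^ 2)

/-- **`familyTwoPieceJoint` is decided** (`not_jointCloses_of_invisible`).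
[cite: Zhang2022LandauSiegel, §2 Props. 2.4–2.6, (2.32)–(2.33); §7 (7.2) p.44] -/
theorem familyTwoPieceJoint_decided : familyTwoPieceJoint.Decided :=
  fun d h _ hX => not_jointCloses_of_invisible hX h.2.1 h.2.2.1 h.2.2.2 d.s

/-- Forgetting the probe maps the class into `familyTwoPiece`'s class (same design, POS currency there).
[cite: Zhang2022LandauSiegel, §7 (7.2) p.44] -/
theorem familyTwoPieceJoint_toTwoPiece (d : JointDesign) (h : familyTwoPieceJoint.InClass d) :
    familyTwoPiece.InClass (d.θ, d.u, d.u', d.v, d.v', d.s) :=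
  ⟨h.1, h.2.1, h.2.2.1⟩

/-- The member `s·g⋆ ⊕ φ_θ` judged against the probe `g⋆`. [cite: Zhang2022LandauSiegel, §7 (7.2) p.44] -/
def jointDesignStar (θ : ℝ) (s : ℂ) : JointDesign :=
  ⟨θ, gStar, gStar', phiT θ, phiT' θ, s, gStar, gStar'⟩

/-- Non-vacuity (C4): `jointDesignStar θ s` is in the class for every `θ ≥ 1` (e.g. `θ = 21/20`, `5/2`).
[cite: Zhang2022LandauSiegel, §7 (7.2) p.44] -/
theorem familyTwoPieceJoint_inClass_star (hθ : 1 ≤ θ) (s : ℂ) :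
    familyTwoPieceJoint.InClass (jointDesignStar θ s) :=
  ⟨hθ, inClassPiece_gStar, overhangPiece_phiT hθ, inClassPiece_gStar⟩

/-- … in particular at `θ = 21/20` and `θ = 5/2`. [cite: Zhang2022LandauSiegel, §7 (7.2) p.44] -/
theorem familyTwoPieceJoint_inClass_examples (s : ℂ) :
    familyTwoPieceJoint.InClass (jointDesignStar (21 / 20) s) ∧
      familyTwoPieceJoint.InClass (jointDesignStar (5 / 2) s) :=
  ⟨familyTwoPieceJoint_inClass_star (by norm_num) s, familyTwoPieceJoint_inClass_star (by norm_num) s⟩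

/-- **The slot of `familyTwoPieceJoint` is load-bearing**: with the hypothesis `InvisibleOverhang θ X`
deleted, the verdict FAILS on the member `jointDesignStar θ s` at every `θ > 1` (the world `X = 0` closes,
`jointCloses_zero`). [cite: Zhang2022LandauSiegel, §7 (7.2) p.44] -/
theorem familyTwoPieceJoint_slot_loadBearing (hθ : 1 < θ) (s : ℂ) :
    familyTwoPieceJoint.InClass (jointDesignStar θ s) ∧
      ¬ (∀ X : PairFunctional,
          ¬ (twoPieceMainTerm θ X gStar gStar' (phiT θ) (phiT' θ) s * mainTermForm gStar gStar'
              < ‖twoPieceCross θ X gStar gStar' (phiT θ) (phiT' θ) s gStar gStar'‖ ^ 2)) :=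
  ⟨familyTwoPieceJoint_inClass_star hθ.le s, fun h => h 0 (jointCloses_zero hθ s)⟩

/-- **`R⁺ ++ [familyTwoPieceJoint]` is decided** (`RepairRplus.rplus_extend`; the running assembly
`RepairRplusPlus` appends the family to the class of record). [cite: Zhang2022LandauSiegel, §2 (2.32)–(2.33); §7 (7.2) p.44] -/
theorem rplus_joint_decided : ClassDecided (Rplus ++ [familyTwoPieceJoint]) :=
  rplus_extend familyTwoPieceJoint_decided

end Repair

end Literature.NumberTheory.LFunctions.Zhang2022
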